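import Summits.BirchSwinnertonDyer.BirchSwinnertonDyer.Theorems.ResidualThetaTransportAtTwoSignedMuVanishingAtTwoPlusCuspSpanSchreier
import HarnessLib

/-!
# Route `ResidualThetaTransportAtTwo`, crux Kμ⁺ `SignedMuVanishingAtTwoPlus` (stmt-BirchSwinnertonDyer-20689), line
# `birth`, stub `stub_flatMuZeroAtTwo`: the CERTIFICATE THEOREM — `Γ₁'(N) ≤ M_N` from a `decide`-checked coset table

Cell `bsd-wall`, width seat `bsd-wall-rtt-p4-w2` (g5). THEOREMS ONLY (no `def`, no named fact, no `sorry`); helper `--supports`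
the crux; closes nothing; BSD is not proved by this. Sequel of `…CuspSpanSchreier` (monoid generation of `SL(2, ℤ)` by `S, T`,
Schreier's lemma along a table, soundness of `E/D` factorisation lists): here the three are assembled into ONE theorem
`gamma1_le_closure_of_certTable` whose hypotheses are finite, decidable statements about a table of natural numbers / integers
(the level files, e.g. `…CuspSpanCert35`, instantiate the table and discharge every hypothesis by `decide`). The conclusion is the
membership form of the node (G″)_N of `…CuspSpanGamma1` (w3 g3), hence `CuspSpanEvenAtTwo N` by
`cuspSpanEvenAtTwo_of_gamma1_le_closure`. The table format: `HL` = the scalars `±⟨4⟩ mod N`; entries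
`(r, q, ((h_S, r_S), F_S), ((h_T, r_T), F_T))` — a representative `r ∈ (ℤ/N)²` of a class of primitive rows modulo `HL`, an integer
matrix `q` of determinant `1` labelling it, and for `s ∈ {S, T}` the successor `row(r)·s = h_s • r_s` and a factorisation `F_s` of the
Schreier element `q·s·q(r_s)⁻¹` into (inverses of) elements of `Γ₀(N)` of trace `0, ±1, ±2` or lower-right entry `±4^k` (`k ≤ 10`).

References: O. Schreier, Abh. Math. Sem. Hamburg 5 (1927) 161–183; A. W. Knapp, *Elliptic curves* (1992) Prop. 11.22 [Knapp1993];
R. Pollack, Duke Math. J. 118 (2003) Conj. 6.3 [Pollack2003].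
-/

set_option autoImplicit false
set_option linter.dupNamespace false

open scoped MatrixGroups

open CongruenceSubgroup Matrix.SpecialLinearGroup ModularGroup

namespace Summit.BirchSwinnertonDyer.BirchSwinnertonDyer.Theorems.SignedMuAtTwo

/-! ## §5. The certificate theorem: `Γ₁'(N) ≤ M_N` from a checked coset table -/

section Cert

/-- **`Γ₁'(N) ≤ M_N` from a finite certificate.** DATA (natural numbers, read mod `N`): a list `HL` of scalars (the subgroup
`±⟨4⟩ ≤ (ℤ/N)ˣ`) and a table `TAB` whose entries are `(r, q, ((h_S, r_S), F_S), ((h_T, r_T), F_T))`: `r` a row-class representative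
in `(ℤ/N)²`, `q = (a, b, c, d)` an integer matrix of determinant `1` labelling it, and for each generator `s ∈ {S, T}` the successor
data — `row(r)·s = h_s • r_s` with `h_s ∈ HL`, `r_s` again a key of the table — and a factorisation list `F_s` of the Schreier element
`q · s · q(r_s)⁻¹` into (inverses of) small-trace / `4^k`-elements of `Γ₀(N)`. CHECKS (all decidable, discharged by `decide` in
the level files): `HL ∋ 1` is closed under products mod `N`; `(0, 1)` is a key; a state `h • r ≡ (0, 1)` (`h ∈ HL`, `r` a key) only
occurs with label `1`; and the per-entry conditions `hchk`. CONCLUSION: every `γ ∈ Γ₀(N)` with `d(γ) ≡ 1 (mod N)` lies in the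
subgroup `M_N` generated by the elements of trace `0, ±1, ±2`, the `4^k`-elements, the squares and the commutators — the membership
form of the node (G″)_N (`…CuspSpanGamma1`). Proof: Schreier's lemma along the table (§2) for the row action of
`SL(2, ℤ) = ⟨S, T⟩` (as a monoid, §1) on `(ℤ/N)²`, states `(h, r)`, base `(1, (0,1))` whose stabiliser is `Γ₁'(N)`, and §4 for
the Schreier elements. [folklore] -/
theorem gamma1_le_closure_of_certTable (N : ℕ) (HL : List ℕ)
    (TAB : List ((ℕ × ℕ) × (ℤ × ℤ × ℤ × ℤ) ×
      ((ℕ × (ℕ × ℕ)) × List (Bool × ℤ × ℤ × ℤ × ℤ)) × ((ℕ × (ℕ × ℕ)) × List (Bool × ℤ × ℤ × ℤ × ℤ))))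
    (hHL1 : (1 : ℕ) ∈ HL)
    (hHL : ∀ x ∈ HL, ∀ y ∈ HL, ((x * y : ℕ) : ZMod N) ∈ HL.map (fun n : ℕ ↦ (n : ZMod N)))
    (h01 : ((0 : ℕ), (1 : ℕ)) ∈ TAB.map Prod.fst)
    (hfix : ∀ h ∈ HL, ∀ e ∈ TAB, (h : ZMod N) * (e.1.1 : ZMod N) = 0 → (h : ZMod N) * (e.1.2 : ZMod N) = 1 →
      e.2.1 = (1, 0, 0, 1))
    (hchk : ∀ e ∈ TAB,
      e.2.1.1 * e.2.1.2.2.2 - e.2.1.2.1 * e.2.1.2.2.1 = 1 ∧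
      (e.2.2.1.1.1 ∈ HL ∧ e.2.2.1.1.2 ∈ TAB.map Prod.fst ∧
        (((e.1.2 : ℕ) : ZMod N) = (e.2.2.1.1.1 : ZMod N) * (e.2.2.1.1.2.1 : ZMod N) ∧
          -((e.1.1 : ℕ) : ZMod N) = (e.2.2.1.1.1 : ZMod N) * (e.2.2.1.1.2.2 : ZMod N)) ∧
        (∀ f ∈ e.2.2.1.2, f.2.1 * f.2.2.2.2 - f.2.2.1 * f.2.2.2.1 = 1 ∧ (N : ℤ) ∣ f.2.2.2.1 ∧
          ((f.2.1 + f.2.2.2.2).natAbs ≤ 2 ∨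
            (f.2.2.2.2).natAbs ∈ [4, 16, 64, 256, 1024, 4096, 16384, 65536, 262144, 1048576])) ∧
        (∀ e' ∈ TAB, e'.1 = e.2.2.1.1.2 →
          (e.2.1.2.1 * e'.2.1.2.2.2 + e.2.1.1 * e'.2.1.2.2.1,
            -(e.2.1.2.1 * e'.2.1.2.1) - e.2.1.1 * e'.2.1.1,
            e.2.1.2.2.2 * e'.2.1.2.2.2 + e.2.1.2.2.1 * e'.2.1.2.2.1,
            -(e.2.1.2.2.2 * e'.2.1.2.1) - e.2.1.2.2.1 * e'.2.1.1) =
          e.2.2.1.2.foldl (fun (acc : ℤ × ℤ × ℤ × ℤ) (f : Bool × ℤ × ℤ × ℤ × ℤ) ↦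
            if f.1 then
              (acc.1 * f.2.2.2.2 + acc.2.1 * (-f.2.2.2.1), acc.1 * (-f.2.2.1) + acc.2.1 * f.2.1,
                acc.2.2.1 * f.2.2.2.2 + acc.2.2.2 * (-f.2.2.2.1), acc.2.2.1 * (-f.2.2.1) + acc.2.2.2 * f.2.1)
            else
              (acc.1 * f.2.1 + acc.2.1 * f.2.2.2.1, acc.1 * f.2.2.1 + acc.2.1 * f.2.2.2.2,
                acc.2.2.1 * f.2.1 + acc.2.2.2 * f.2.2.2.1, acc.2.2.1 * f.2.2.1 + acc.2.2.2 * f.2.2.2.2))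
            (1, 0, 0, 1))) ∧
      (e.2.2.2.1.1 ∈ HL ∧ e.2.2.2.1.2 ∈ TAB.map Prod.fst ∧
        (((e.1.1 : ℕ) : ZMod N) = (e.2.2.2.1.1 : ZMod N) * (e.2.2.2.1.2.1 : ZMod N) ∧
          ((e.1.1 : ℕ) : ZMod N) + (e.1.2 : ZMod N) = (e.2.2.2.1.1 : ZMod N) * (e.2.2.2.1.2.2 : ZMod N)) ∧
        (∀ f ∈ e.2.2.2.2, f.2.1 * f.2.2.2.2 - f.2.2.1 * f.2.2.2.1 = 1 ∧ (N : ℤ) ∣ f.2.2.2.1 ∧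
          ((f.2.1 + f.2.2.2.2).natAbs ≤ 2 ∨
            (f.2.2.2.2).natAbs ∈ [4, 16, 64, 256, 1024, 4096, 16384, 65536, 262144, 1048576])) ∧
        (∀ e' ∈ TAB, e'.1 = e.2.2.2.1.2 →
          (e.2.1.1 * e'.2.1.2.2.2 - (e.2.1.1 + e.2.1.2.1) * e'.2.1.2.2.1,
            -(e.2.1.1 * e'.2.1.2.1) + (e.2.1.1 + e.2.1.2.1) * e'.2.1.1,
            e.2.1.2.2.1 * e'.2.1.2.2.2 - (e.2.1.2.2.1 + e.2.1.2.2.2) * e'.2.1.2.2.1,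
            -(e.2.1.2.2.1 * e'.2.1.2.1) + (e.2.1.2.2.1 + e.2.1.2.2.2) * e'.2.1.1) =
          e.2.2.2.2.foldl (fun (acc : ℤ × ℤ × ℤ × ℤ) (f : Bool × ℤ × ℤ × ℤ × ℤ) ↦
            if f.1 then
              (acc.1 * f.2.2.2.2 + acc.2.1 * (-f.2.2.2.1), acc.1 * (-f.2.2.1) + acc.2.1 * f.2.1,
                acc.2.2.1 * f.2.2.2.2 + acc.2.2.2 * (-f.2.2.2.1), acc.2.2.1 * (-f.2.2.1) + acc.2.2.2 * f.2.1)
            else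
              (acc.1 * f.2.1 + acc.2.1 * f.2.2.2.1, acc.1 * f.2.2.1 + acc.2.1 * f.2.2.2.2,
                acc.2.2.1 * f.2.1 + acc.2.2.2 * f.2.2.2.1, acc.2.2.1 * f.2.2.1 + acc.2.2.2 * f.2.2.2.2))
            (1, 0, 0, 1)))) :
    Gamma1' N ≤ Subgroup.closure
      ({γ : Gamma0 N | ((γ : SL(2, ℤ)) 0 0 + (γ : SL(2, ℤ)) 1 1).natAbs ≤ 2} ∪
        {γ : Gamma0 N | ∃ k : ℕ, 1 ≤ k ∧ ((γ : SL(2, ℤ)) 1 1).natAbs = 4 ^ k} ∪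
        {γ : Gamma0 N | ∃ g : Gamma0 N, g * g = γ} ∪ commutatorSet (Gamma0 N)) := by
  classical
  intro γ hγ
  set M : Subgroup (Gamma0 N) := Subgroup.closure
      ({γ : Gamma0 N | ((γ : SL(2, ℤ)) 0 0 + (γ : SL(2, ℤ)) 1 1).natAbs ≤ 2} ∪
        {γ : Gamma0 N | ∃ k : ℕ, 1 ≤ k ∧ ((γ : SL(2, ℤ)) 1 1).natAbs = 4 ^ k} ∪
        {γ : Gamma0 N | ∃ g : Gamma0 N, g * g = γ} ∪ commutatorSet (Gamma0 N)) with hM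
  set K : Subgroup SL(2, ℤ) := M.map (Gamma0 N).subtype with hK
  have hE : ∀ g : SL(2, ℤ), (N : ℤ) ∣ g 1 0 → (g 0 0 + g 1 1).natAbs ≤ 2 → g ∈ K := by
    intro g hc ht
    have hg0 : g ∈ Gamma0 N := by
      rw [Gamma0_mem]; exact (ZMod.intCast_zmod_eq_zero_iff_dvd _ _).mpr hc
    exact ⟨⟨g, hg0⟩, Subgroup.subset_closure (Or.inl (Or.inl (Or.inl ht))), rfl⟩
  have hD : ∀ g : SL(2, ℤ), (N : ℤ) ∣ g 1 0 → (∃ k : ℕ, 1 ≤ k ∧ (g 1 1).natAbs = 4 ^ k) → g ∈ K := by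
    intro g hc ht
    have hg0 : g ∈ Gamma0 N := by
      rw [Gamma0_mem]; exact (ZMod.intCast_zmod_eq_zero_iff_dvd _ _).mpr hc
    exact ⟨⟨g, hg0⟩, Subgroup.subset_closure (Or.inl (Or.inl (Or.inr ht))), rfl⟩
  suffices hγK : (γ : SL(2, ℤ)) ∈ K by
    obtain ⟨m, hm, hmγ⟩ := hγK
    have : m = γ := Subtype.ext hmγ
    rw [← this]; exact hm
  -- entries of `S`, `T`, `1`
  have eS : ∀ i j : Fin 2, (S : SL(2, ℤ)) i j = !![(0 : ℤ), -1; 1, 0] i j := fun i j ↦ by rw [← coe_S]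
  have eT : ∀ i j : Fin 2, (T : SL(2, ℤ)) i j = !![(1 : ℤ), 1; 0, 1] i j := fun i j ↦ by rw [← coe_T]
  have e1 : ∀ i j : Fin 2, (1 : SL(2, ℤ)) i j = (1 : Matrix (Fin 2) (Fin 2) ℤ) i j := fun i j ↦ by
    rw [← Matrix.SpecialLinearGroup.coe_one]
  -- keys give entries
  have hkey : ∀ r : ℕ × ℕ, r ∈ TAB.map Prod.fst →
      ∃ e ∈ TAB, e.1 = r ∧ TAB.find? (fun e ↦ decide (e.1 = r)) = some e := by
    intro r hr
    obtain ⟨e₀, he₀, he₀r⟩ := List.mem_map.mp hr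
    have hsome : (TAB.find? (fun e ↦ decide (e.1 = r))).isSome := by
      rw [List.find?_isSome]; exact ⟨e₀, he₀, by simpa using he₀r⟩
    obtain ⟨e, he⟩ := Option.isSome_iff_exists.mp hsome
    refine ⟨e, List.mem_of_find?_eq_some he, ?_, he⟩
    have := List.find?_some he
    simpa using this
  -- scalars: membership in `HL` read mod `N`
  have hmul : ∀ (x : ZMod N) (y : ℕ), x ∈ HL.map (fun n : ℕ ↦ (n : ZMod N)) → y ∈ HL →
      x * (y : ZMod N) ∈ HL.map (fun n : ℕ ↦ (n : ZMod N)) := by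
    intro x y hx hy
    obtain ⟨x₀, hx₀, rfl⟩ := List.mem_map.mp hx
    have := hHL x₀ hx₀ y hy
    push_cast at this
    exact this
  -- the Schreier data
  refine mem_of_schreier_table (G := SL(2, ℤ)) (X := ZMod N × ZMod N) (St := ZMod N × (ℕ × ℕ))
    (fun v g ↦ (v.1 * ((g 0 0 : ℤ) : ZMod N) + v.2 * ((g 1 0 : ℤ) : ZMod N),
      v.1 * ((g 0 1 : ℤ) : ZMod N) + v.2 * ((g 1 1 : ℤ) : ZMod N)))
    (fun v g h ↦ ?_) (fun v ↦ ?_) sl2z_submonoid_closure_eq_top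
    (fun σ ↦ σ.1 ∈ HL.map (fun n : ℕ ↦ (n : ZMod N)) ∧ σ.2 ∈ TAB.map Prod.fst)
    (fun σ ↦ (σ.1 * (σ.2.1 : ZMod N), σ.1 * (σ.2.2 : ZMod N)))
    (fun σ s ↦ match TAB.find? (fun e ↦ decide (e.1 = σ.2)) with
      | some e => if s = S then (σ.1 * (e.2.2.1.1.1 : ZMod N), e.2.2.1.1.2)
          else (σ.1 * (e.2.2.2.1.1 : ZMod N), e.2.2.2.1.2)
      | none => σ)
    (fun σ ↦ match TAB.find? (fun e ↦ decide (e.1 = σ.2)) with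
      | some e => if hq : e.2.1.1 * e.2.1.2.2.2 - e.2.1.2.1 * e.2.1.2.2.1 = 1 then
          ⟨!![e.2.1.1, e.2.1.2.1; e.2.1.2.2.1, e.2.1.2.2.2], by
            rw [Matrix.det_fin_two_of]; linear_combination hq⟩ else 1
      | none => 1)
    K (1, ((0 : ℕ), (1 : ℕ))) ⟨List.mem_map.mpr ⟨1, hHL1, by push_cast; ring⟩, h01⟩ ?_ ?_ ?_
  · -- product rule
    simp only [Prod.mk.injEq]
    exact ⟨row_mul_fst v.1 v.2 g h, row_mul_snd v.1 v.2 g h⟩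
  · -- identity
    simp only [e1, Matrix.one_apply_eq, Matrix.one_apply_ne (show (0 : Fin 2) ≠ 1 by decide),
      Matrix.one_apply_ne (show (1 : Fin 2) ≠ 0 by decide), Int.cast_one, Int.cast_zero, mul_one, mul_zero,
      add_zero, zero_add]
  · -- the step: good successor, compatible vector, Schreier element in `K`
    rintro ⟨h, r⟩ ⟨hh, hr⟩ s hs
    obtain ⟨e, he, her, hfe⟩ := hkey r hr
    obtain ⟨hdet, ⟨hSh, hSr, ⟨hS1, hS2⟩, hSF, hSP⟩, ⟨hTh, hTr, ⟨hT1, hT2⟩, hTF, hTP⟩⟩ := hchk e he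
    have hTS : (T : SL(2, ℤ)) ≠ S := by
      intro hTS'
      have := congrArg (fun g : SL(2, ℤ) ↦ g 1 0) hTS'
      simp [eT, eS] at this
    rcases hs with rfl | rfl
    · -- generator `S`
      obtain ⟨e', he', he'r, hfe'⟩ := hkey _ hSr
      have hdet' := (hchk e' he').1
      simp only [hfe, hfe', if_true, dif_pos hdet, dif_pos hdet']
      refine ⟨⟨hmul h _ hh hSh, hSr⟩, ?_, ?_⟩
      · simp only [Prod.mk.injEq, eS]
        simp only [Matrix.of_apply, Matrix.cons_val', Matrix.cons_val_zero, Matrix.cons_val_one,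
          Matrix.cons_val_fin_one, Int.cast_zero, Int.cast_one, Int.cast_neg, mul_zero, mul_one, zero_add,
          add_zero, mul_neg]
        rw [her] at hS1 hS2
        constructor
        · rw [mul_assoc, ← hS1]
        · rw [mul_assoc, ← hS2]; ring
      · set qm : SL(2, ℤ) := ⟨!![e.2.1.1, e.2.1.2.1; e.2.1.2.2.1, e.2.1.2.2.2], by
            rw [Matrix.det_fin_two_of]; linear_combination hdet⟩ with hqm
        set qm' : SL(2, ℤ) := ⟨!![e'.2.1.1, e'.2.1.2.1; e'.2.1.2.2.1, e'.2.1.2.2.2], by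
            rw [Matrix.det_fin_two_of]; linear_combination hdet'⟩ with hqm'
        refine mem_of_factorList K hE hD _ hSF 1 _ K.one_mem ?_
        have hP := hSP e' he' he'r
        have h4 := sl2_mul_apply (qm * S) qm'⁻¹
        have h3 := sl2_mul_apply qm S
        have hi := sl2_inv_apply qm'
        have q00 : qm 0 0 = e.2.1.1 := rfl
        have q01 : qm 0 1 = e.2.1.2.1 := rfl
        have q10 : qm 1 0 = e.2.1.2.2.1 := rfl
        have q11 : qm 1 1 = e.2.1.2.2.2 := rfl
        have q00' : qm' 0 0 = e'.2.1.1 := rfl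
        have q01' : qm' 0 1 = e'.2.1.2.1 := rfl
        have q10' : qm' 1 0 = e'.2.1.2.2.1 := rfl
        have q11' : qm' 1 1 = e'.2.1.2.2.2 := rfl
        rw [h4.1, h4.2.1, h4.2.2.1, h4.2.2.2, h3.1, h3.2.1, h3.2.2.1, h3.2.2.2, hi.1, hi.2.1, hi.2.2.1, hi.2.2.2,
          q00, q01, q10, q11, q00', q01', q10', q11']
        simp only [e1, Matrix.one_apply_eq, Matrix.one_apply_ne (show (0 : Fin 2) ≠ 1 by decide),
          Matrix.one_apply_ne (show (1 : Fin 2) ≠ 0 by decide)]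
        rw [← hP]
        simp only [eS, Matrix.of_apply, Matrix.cons_val', Matrix.cons_val_zero, Matrix.cons_val_one,
          Matrix.cons_val_fin_one, Prod.mk.injEq]
        refine ⟨by ring, by ring, by ring, by ring⟩
    · -- generator `T`
      obtain ⟨e', he', he'r, hfe'⟩ := hkey _ hTr
      have hdet' := (hchk e' he').1
      simp only [hfe, hfe', if_neg hTS, dif_pos hdet, dif_pos hdet']
      refine ⟨⟨hmul h _ hh hTh, hTr⟩, ?_, ?_⟩
      · simp only [Prod.mk.injEq, eT]
        simp only [Matrix.of_apply, Matrix.cons_val', Matrix.cons_val_zero, Matrix.cons_val_one,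
          Matrix.cons_val_fin_one, Int.cast_zero, Int.cast_one, mul_zero, mul_one, add_zero]
        rw [her] at hT1 hT2
        constructor
        · rw [mul_assoc, ← hT1]
        · rw [mul_assoc, ← hT2]; ring
      · set qm : SL(2, ℤ) := ⟨!![e.2.1.1, e.2.1.2.1; e.2.1.2.2.1, e.2.1.2.2.2], by
            rw [Matrix.det_fin_two_of]; linear_combination hdet⟩ with hqm
        set qm' : SL(2, ℤ) := ⟨!![e'.2.1.1, e'.2.1.2.1; e'.2.1.2.2.1, e'.2.1.2.2.2], by
            rw [Matrix.det_fin_two_of]; linear_combination hdet'⟩ with hqm'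
        refine mem_of_factorList K hE hD _ hTF 1 _ K.one_mem ?_
        have hP := hTP e' he' he'r
        have h4 := sl2_mul_apply (qm * T) qm'⁻¹
        have h3 := sl2_mul_apply qm T
        have hi := sl2_inv_apply qm'
        have q00 : qm 0 0 = e.2.1.1 := rfl
        have q01 : qm 0 1 = e.2.1.2.1 := rfl
        have q10 : qm 1 0 = e.2.1.2.2.1 := rfl
        have q11 : qm 1 1 = e.2.1.2.2.2 := rfl
        have q00' : qm' 0 0 = e'.2.1.1 := rfl
        have q01' : qm' 0 1 = e'.2.1.2.1 := rfl
        have q10' : qm' 1 0 = e'.2.1.2.2.1 := rfl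
        have q11' : qm' 1 1 = e'.2.1.2.2.2 := rfl
        rw [h4.1, h4.2.1, h4.2.2.1, h4.2.2.2, h3.1, h3.2.1, h3.2.2.1, h3.2.2.2, hi.1, hi.2.1, hi.2.2.1, hi.2.2.2,
          q00, q01, q10, q11, q00', q01', q10', q11']
        simp only [e1, Matrix.one_apply_eq, Matrix.one_apply_ne (show (0 : Fin 2) ≠ 1 by decide),
          Matrix.one_apply_ne (show (1 : Fin 2) ≠ 0 by decide)]
        rw [← hP]
        simp only [eT, Matrix.of_apply, Matrix.cons_val', Matrix.cons_val_zero, Matrix.cons_val_one,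
          Matrix.cons_val_fin_one, Prod.mk.injEq]
        refine ⟨by ring, by ring, by ring, by ring⟩
  · -- states over the base vector have label `1`
    rintro ⟨h, r⟩ ⟨hh, hr⟩ hv
    obtain ⟨e, he, her, hfe⟩ := hkey r hr
    obtain ⟨h₀, hh₀, rfl⟩ := List.mem_map.mp hh
    simp only [Prod.mk.injEq, Nat.cast_zero, Nat.cast_one, mul_zero, mul_one] at hv
    have hq : e.2.1 = (1, 0, 0, 1) := hfix h₀ hh₀ e he (by rw [her]; exact hv.1) (by rw [her]; exact hv.2)
    have hdet := (hchk e he).1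
    simp only [hfe, dif_pos hdet]
    have h00 : e.2.1.1 = 1 := by rw [hq]
    have h01 : e.2.1.2.1 = 0 := by rw [hq]
    have h10 : e.2.1.2.2.1 = 0 := by rw [hq]
    have h11 : e.2.1.2.2.2 = 1 := by rw [hq]
    set qm : SL(2, ℤ) := ⟨!![e.2.1.1, e.2.1.2.1; e.2.1.2.2.1, e.2.1.2.2.2], by
        rw [Matrix.det_fin_two_of]; linear_combination hdet⟩ with hqm
    have : qm = 1 := by
      apply sl2_ext
      · show e.2.1.1 = (1 : SL(2, ℤ)) 0 0
        rw [h00, e1, Matrix.one_apply_eq]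
      · show e.2.1.2.1 = (1 : SL(2, ℤ)) 0 1
        rw [h01, e1, Matrix.one_apply_ne (show (0 : Fin 2) ≠ 1 by decide)]
      · show e.2.1.2.2.1 = (1 : SL(2, ℤ)) 1 0
        rw [h10, e1, Matrix.one_apply_ne (show (1 : Fin 2) ≠ 0 by decide)]
      · show e.2.1.2.2.2 = (1 : SL(2, ℤ)) 1 1
        rw [h11, e1, Matrix.one_apply_eq]
    rw [this]; exact K.one_mem
  · -- `γ ∈ Γ₁'(N)` fixes the base vector
    have hc : ((((γ : SL(2, ℤ)) 1 0 : ℤ) : ZMod N)) = 0 := by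
      have := γ.2; rw [Gamma0_mem] at this; exact this
    have hd : ((((γ : SL(2, ℤ)) 1 1 : ℤ) : ZMod N)) = 1 := by
      rw [Gamma1_mem'] at hγ; exact hγ
    simp only [Prod.mk.injEq, Nat.cast_zero, Nat.cast_one, one_mul, mul_zero, mul_one, zero_mul, zero_add]
    exact ⟨hc, hd⟩

end Cert

end Summit.BirchSwinnertonDyer.BirchSwinnertonDyer.Theorems.SignedMuAtTwo
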